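import Summits.Ventures.CertifiedArithmetic.LowPrec.SRPythagorasLevels
import Summits.Ventures.CertifiedArithmetic.LowPrec.SRPythagorasAlignedTrunc
import HarnessLib

/-!
# CXX — The LIABILITY POTENTIAL (I): two-copy expectations, the pair liability `ℓ_E`, the two-point
# inequality `PairLE`, and the accounting theorem `E(ŝₙ − sₙ)² + Λₙ ≤ n·G²/4 + (n·E)²`

HONEST FRAMING: certified error envelopes and provably optimal rounding/accumulation schemes for
low-precision formats under stated cost models; every table by two implementations; no hardware or
vendor claims.

SETTING (CX–CXIX).  `StochasticA` with `N` random bits (`probAwayA N`; the `SRFF` of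
[FitzgibbonFelix2025], `SR_{p,r}` of [ElararEtAl2025]) accumulates `ŝₖ₊₁ = round(ŝₖ + xₖ)` in a window
whose cell widths are `2^j·g`, `j ≤ J`; `G = 2^J·g`, `E = G/2^N` the largest one-step mean truncation.
The PYTHAGOREAN LAW `E(ŝₙ − sₙ)² ≤ n·G²/4 + (n·E)²` (the mean-square shape of
[ConnollyHighamMary2021, Lemma 4.4, Thm 4.6] plus the squared bias of limited random bits) is proved
in this series for `N ≥ J`, `N ≤ 2` and bounded jumps, and is OPEN for `3 ≤ N < J` (CXV); every
TIME-LOCAL certificate is false there (node budgets CX–CXV; the level budget `LevelLE` of CXVII —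
kernel witness in CXXIII): a covariance GAIN collected at one level is spent as differential
truncation at a LATER level.

THE IDEA (files CXX–CXXIII): charge that future cost to the PRESENT PAIR of states.  For the level-`k`
state distribution let `t, t'` be two INDEPENDENT copies of the state (two-copy expectation `acc2`)
and define the LIABILITY `Λₖ = E[ℓ_E(t, t')]`, `ℓ_E(a, b) = |a − b|·((−|a − b|) mod E)`
(`pairLiab`, `liabQ`): nonnegative, `< |a − b|·E`, zero exactly on `E`-congruent pairs, shift invariant.

WHAT IS PROVED HERE (any finite format `F`, any rule `q` with values in `[0,1]`; exact, no `sorry`).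
* §1 the calculus of two-copy expectations (`acc2_succ/add/sub/left/right/mul`), the level-state
  predicate `Reach`, and monotonicity of (two-copy) expectations under pointwise domination on the
  reachable states (`accExpQ_mono_reach`, `acc2_mono_reach`).
* §2 `acc_sq_add_liab_le`, `acc_sq_le_of_pairLE` — the ACCOUNTING THEOREM: if at every level `k < n`
  every pair of reachable states `t, t'` satisfies the TWO-POINT INEQUALITY `PairLE` at
  `c = t + xₖ`, `c' = t' + xₖ`,
  `E[ℓ_E(round c, round′ c')] ≤ ℓ_E(c, c') + (c − c')(y(c) − y(c'))
      + ½·[G²/4 − π(1−π)w² + E(E − y)](c) + ½·[same](c')`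
  (independent roundings; `π = pUpQ`, `w` the cell width, `y = truncQ` the mean truncation,
  `vslackQ = G²/4 − π(1−π)w²`), and every truncation met lies in `[0, E]`, then
  `E(ŝₙ − sₙ)² + Λₙ ≤ n·G²/4 + (n·E)²` and `0 ≤ sₙ − E ŝₙ ≤ n·E`.  One level of the induction:
  `Q_{k+1} = Q_k + E[π(1−π)w²] + E[y²] − 2E[(ŝₖ − sₖ)·y]`; the centred cross term is the two-copy
  expectation `−E[(c − c')(y(c) − y(c'))]`, which `PairLE` trades against `Λₖ − Λₖ₊₁` plus the unused
  variance and bias budgets; the mean part is at most `2kE·E[y]`.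

`PairLE` is established on TWO-RUN windows for StochasticA, every `N ≥ 1`, in CXXI–CXXIII, which
yields the law there (`TwoRunWindow.acc_sq_le_twoRun`).  On general format windows `PairLE` is FALSE
(CXXIII, scope note) — the accounting theorem is stated for any format so that a sharper potential can
reuse it.  References: [ConnollyHighamMary2021], [ElararEtAl2025], [FitzgibbonFelix2025], IEEE P3109
interim report (StochasticA).  The liability functional is, as far as our searches of the SR
literature go, not in print: a second-moment COUPLING functional of the state distribution rather than
a per-state or per-level budget.
-/

namespace Summit.Ventures.CertifiedArithmetic.LowPrec.SR

open Literature.ComputerArithmetic.ConnollyHighamMary2021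
open Finset

variable {K : Type*} [Field K] [LinearOrder K] [IsStrictOrderedRing K] [FloorRing K]

namespace LimitedBits

/-! ### 1. Two-copy expectations over one level, and the states of a level -/

/-- The TWO-COPY expectation of level `k`: `E[h(t, t')]` for `t, t'` two INDEPENDENT copies of the
level-`k` state `ŝ_k` of the accumulation from `s` with summands `x`. -/
def acc2 (F : Finset K) (q : K → K) (x : ℕ → K) (k : ℕ) (h : K → K → K) (s : K) : K :=
  accExpQ F q x k (fun t => accExpQ F q x k (fun t' => h t t') s) s

/-- `Reach F x s k t`: `t` is a state of level `k` of the outcome tree from `s` (first-step form). -/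
def Reach (F : Finset K) : (ℕ → K) → K → ℕ → K → Prop
  | _, s, 0, t => t = s
  | x, s, k + 1, t => Reach F (fun i => x (i + 1)) (up F (s + x 0)) k t ∨
      Reach F (fun i => x (i + 1)) (dn F (s + x 0)) k t

omit [IsStrictOrderedRing K] [FloorRing K] in
/-- Constants integrate to themselves. -/
theorem accExpQ_const (F : Finset K) (q : K → K) (a : K) :
    ∀ (k : ℕ) (x : ℕ → K) (s : K), accExpQ F q x k (fun _ => a) s = a
  | 0, _, _ => rfl
  | k + 1, x, s => by
      show stepQ F q (s + x 0) (fun s' => accExpQ F q (fun i => x (i + 1)) k (fun _ => a) s') = a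
      have e : (fun s' => accExpQ F q (fun i => x (i + 1)) k (fun _ => a) s') = fun _ => a := by
        funext s'; exact accExpQ_const F q a k _ s'
      rw [e]; unfold stepQ; ring

omit [IsStrictOrderedRing K] [FloorRing K] in
/-- Scalars come out. -/
theorem accExpQ_const_mul (F : Finset K) (q : K → K) (x : ℕ → K) (k : ℕ) (a : K) (f : K → K)
    (s : K) : accExpQ F q x k (fun t => a * f t) s = a * accExpQ F q x k f s := by
  have e : (fun t => a * f t) = fun t => a * f t + 0 * f t := by funext t; ring
  rw [e, accExpQ_lin]; ring

omit [IsStrictOrderedRing K] [FloorRing K] in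
/-- A two-point step commutes with a level expectation (both are finite linear functionals). -/
theorem stepQ_accExpQ_comm (F : Finset K) (q : K → K) (x : ℕ → K) (k : ℕ) (c : K)
    (G : K → K → K) (s : K) :
    stepQ F q c (fun a => accExpQ F q x k (G a) s)
      = accExpQ F q x k (fun t' => stepQ F q c (fun a => G a t')) s := by
  unfold stepQ; rw [accExpQ_lin]

omit [IsStrictOrderedRing K] [FloorRing K] in
/-- **One more level, two copies**: `E₂^{k+1}[h] = E₂^{k}[(t,t') ↦ E_{a∼c(t)} E_{b∼c(t')} h(a,b)]`,
`c(t) = t + x_k` (the two copies round independently; the diagonal `t = t'` is the sibling pair). -/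
theorem acc2_succ (F : Finset K) (q : K → K) (x : ℕ → K) (k : ℕ) (h : K → K → K) (s : K) :
    acc2 F q x (k + 1) h s
      = acc2 F q x k (fun t t' => stepQ F q (t + x k) (fun a => stepQ F q (t' + x k) (fun b => h a b))) s := by
  unfold acc2
  rw [accExpQ_succ_last]
  congr 1; funext t
  rw [stepQ_accExpQ_comm, accExpQ_succ_last]
  congr 1; funext t'
  unfold stepQ; ring

omit [IsStrictOrderedRing K] [FloorRing K] in
/-- Two-copy expectation of a sum. -/
theorem acc2_add (F : Finset K) (q : K → K) (x : ℕ → K) (k : ℕ) (h₁ h₂ : K → K → K) (s : K) :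
    acc2 F q x k (fun t t' => h₁ t t' + h₂ t t') s = acc2 F q x k h₁ s + acc2 F q x k h₂ s := by
  unfold acc2
  have e : (fun t => accExpQ F q x k (fun t' => h₁ t t' + h₂ t t') s)
      = fun t => 1 * accExpQ F q x k (fun t' => h₁ t t') s + 1 * accExpQ F q x k (fun t' => h₂ t t') s := by
    funext t
    have e1 : (fun t' => h₁ t t' + h₂ t t') = fun t' => 1 * h₁ t t' + 1 * h₂ t t' := by
      funext t'; ring
    rw [e1, accExpQ_lin]
  rw [e, accExpQ_lin]; ring

omit [IsStrictOrderedRing K] [FloorRing K] in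
/-- Two-copy expectation of a difference. -/
theorem acc2_sub (F : Finset K) (q : K → K) (x : ℕ → K) (k : ℕ) (h₁ h₂ : K → K → K) (s : K) :
    acc2 F q x k (fun t t' => h₁ t t' - h₂ t t') s = acc2 F q x k h₁ s - acc2 F q x k h₂ s := by
  unfold acc2
  have e : (fun t => accExpQ F q x k (fun t' => h₁ t t' - h₂ t t') s)
      = fun t => 1 * accExpQ F q x k (fun t' => h₁ t t') s + (-1) * accExpQ F q x k (fun t' => h₂ t t') s := by
    funext t
    have e1 : (fun t' => h₁ t t' - h₂ t t') = fun t' => 1 * h₁ t t' + (-1) * h₂ t t' := by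
      funext t'; ring
    rw [e1, accExpQ_lin]
  rw [e, accExpQ_lin]; ring

omit [IsStrictOrderedRing K] [FloorRing K] in
/-- A function of the first copy only. -/
theorem acc2_left (F : Finset K) (q : K → K) (x : ℕ → K) (k : ℕ) (f : K → K) (s : K) :
    acc2 F q x k (fun t _ => f t) s = accExpQ F q x k f s := by
  unfold acc2
  have e : (fun t => accExpQ F q x k (fun _ => f t) s) = f := by
    funext t; exact accExpQ_const F q (f t) k x s
  rw [e]

omit [IsStrictOrderedRing K] [FloorRing K] in
/-- A function of the second copy only. -/
theorem acc2_right (F : Finset K) (q : K → K) (x : ℕ → K) (k : ℕ) (f : K → K) (s : K) :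
    acc2 F q x k (fun _ t' => f t') s = accExpQ F q x k f s := by
  unfold acc2
  exact accExpQ_const F q _ k x s

omit [IsStrictOrderedRing K] [FloorRing K] in
/-- A product integrates to the product (independence of the two copies). -/
theorem acc2_mul (F : Finset K) (q : K → K) (x : ℕ → K) (k : ℕ) (f h : K → K) (s : K) :
    acc2 F q x k (fun t t' => f t * h t') s = accExpQ F q x k f s * accExpQ F q x k h s := by
  unfold acc2
  have e : (fun t => accExpQ F q x k (fun t' => f t * h t') s)
      = fun t => accExpQ F q x k h s * f t := by
    funext t; rw [accExpQ_const_mul]; ring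
  rw [e, accExpQ_const_mul]; ring

omit [FloorRing K] in
/-- Monotonicity over the STATES OF THE LEVEL: a pointwise inequality on the reachable states
integrates (`q` with values in `[0,1]`). -/
theorem accExpQ_mono_reach (F : Finset K) {q : K → K}
    (hq01 : ∀ θ, 0 ≤ θ → θ ≤ 1 → 0 ≤ q θ ∧ q θ ≤ 1) :
    ∀ (k : ℕ) (x : ℕ → K) (s : K) (f h : K → K), (∀ t, Reach F x s k t → f t ≤ h t) →
      accExpQ F q x k f s ≤ accExpQ F q x k h s
  | 0, x, s, f, h, H => H s (by simp only [Reach])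
  | k + 1, x, s, f, h, H => by
      show stepQ F q (s + x 0) (fun s' => accExpQ F q (fun i => x (i + 1)) k f s')
        ≤ stepQ F q (s + x 0) (fun s' => accExpQ F q (fun i => x (i + 1)) k h s')
      obtain ⟨hp0, hp1⟩ := pUpQ_mem F hq01 (s + x 0)
      have hu := accExpQ_mono_reach F hq01 k (fun i => x (i + 1)) (up F (s + x 0)) f h
        (fun t ht => H t (Or.inl ht))
      have hd := accExpQ_mono_reach F hq01 k (fun i => x (i + 1)) (dn F (s + x 0)) f h
        (fun t ht => H t (Or.inr ht))
      unfold stepQ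
      nlinarith [mul_le_mul_of_nonneg_left hu hp0, mul_le_mul_of_nonneg_left hd (sub_nonneg.mpr hp1)]

omit [FloorRing K] in
/-- Two-copy monotonicity over reachable PAIRS. -/
theorem acc2_mono_reach (F : Finset K) {q : K → K}
    (hq01 : ∀ θ, 0 ≤ θ → θ ≤ 1 → 0 ≤ q θ ∧ q θ ≤ 1) (k : ℕ) (x : ℕ → K) (s : K)
    (h₁ h₂ : K → K → K) (H : ∀ t t', Reach F x s k t → Reach F x s k t' → h₁ t t' ≤ h₂ t t') :
    acc2 F q x k h₁ s ≤ acc2 F q x k h₂ s :=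
  accExpQ_mono_reach F hq01 k x s _ _
    (fun t ht => accExpQ_mono_reach F hq01 k x s _ _ (fun t' ht' => H t t' ht ht'))

/-! ### 2. The pair liability, the two-point inequality, the accounting theorem -/

/-- PAIR LIABILITY at sub-quantum `E`: `ℓ_E(a, b) = |a − b| · ((−|a − b|) mod E)` — the separation
times its distance to the NEXT multiple of `E` above (`0` iff `E ∣ a − b`). -/
def pairLiab (E a b : K) : K := |a - b| * resid (-|a - b|) E

/-- The LIABILITY of level `k`: `Λ_k = E[ℓ_E(t, t')]` over two independent copies of the state. -/
def liabQ (F : Finset K) (q : K → K) (E : K) (x : ℕ → K) (k : ℕ) (s : K) : K :=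
  acc2 F q x k (pairLiab E) s

/-- Expected liability of the two (independently rounded) children of the pre-rounding values
`c, c'`. -/
def pairStepQ (F : Finset K) (q : K → K) (E c c' : K) : K :=
  stepQ F q c (fun a => stepQ F q c' (fun b => pairLiab E a b))

/-- VARIANCE SLACK of one step against the per-step budget: `G²/4 − π(1−π)(⌈c̄⌉ − ⌊c̄⌋)²`. -/
def vslackQ (F : Finset K) (q : K → K) (G c : K) : K :=
  G ^ 2 / 4 - pUpQ F q c * (1 - pUpQ F q c) * (up F c - dn F c) ^ 2

/-- **The two-point inequality** `PairLE F q G E c c'` at pre-rounding values `c, c'`: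
`E ℓ(children) ≤ ℓ(c, c') + (c − c')(y(c) − y(c')) + ½·(V(c) + E(E − y(c)) + V(c') + E(E − y(c')))`,
`y = truncQ` the mean truncation, `V = vslackQ` the variance slack. -/
def PairLE (F : Finset K) (q : K → K) (G E c c' : K) : Prop :=
  pairStepQ F q E c c' ≤ pairLiab E c c' + (c - c') * (truncQ F q c - truncQ F q c')
    + (vslackQ F q G c + E * (E - truncQ F q c) + vslackQ F q G c' + E * (E - truncQ F q c')) / 2

omit [IsStrictOrderedRing K] [FloorRing K] in
/-- `|(a+z) − (b+z)| = |a − b|`. -/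
theorem abs_sub_add_right (a b z : K) : |a + z - (b + z)| = |a - b| := by
  rw [add_sub_add_right_eq_sub]

omit [IsStrictOrderedRing K] in
/-- Translation invariance of the pair liability. -/
theorem pairLiab_add_right (E a b z : K) : pairLiab E (a + z) (b + z) = pairLiab E a b := by
  unfold pairLiab; rw [add_sub_add_right_eq_sub]

omit [IsStrictOrderedRing K] in
/-- The pair liability is symmetric. -/
theorem pairLiab_comm (E a b : K) : pairLiab E a b = pairLiab E b a := by
  unfold pairLiab; rw [abs_sub_comm]

/-- A point owes nothing to itself. -/
theorem pairLiab_self (E a : K) : pairLiab E a a = 0 := by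
  unfold pairLiab; rw [sub_self, abs_zero, zero_mul]

/-- `0 ≤ ℓ_E(a,b) ≤ |a − b|·E` for `E > 0`. -/
theorem pairLiab_nonneg {E : K} (hE : 0 < E) (a b : K) : 0 ≤ pairLiab E a b :=
  mul_nonneg (abs_nonneg _) (resid_nonneg_lt hE).1

/-- `ℓ_E(a,b) ≤ |a − b|·E`. -/
theorem pairLiab_le {E : K} (hE : 0 < E) (a b : K) : pairLiab E a b ≤ |a - b| * E :=
  mul_le_mul_of_nonneg_left (resid_nonneg_lt hE).2.le (abs_nonneg _)

/-- `ℓ` vanishes on separations that are multiples of `E`. -/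
theorem pairLiab_eq_zero_of_dvd {E : K} (hE : 0 < E) {a b : K} {z : ℤ} (hz : a - b = z * E) :
    pairLiab E a b = 0 := by
  unfold pairLiab
  rcases le_total 0 (a - b) with h | h
  · rw [abs_of_nonneg h, hz, show -((z : K) * E) = ((-z : ℤ) : K) * E by push_cast; ring,
      resid_int_mul hE]; ring
  · rw [abs_of_nonpos h, hz, show -(-((z : K) * E)) = ((z : ℤ) : K) * E by ring,
      resid_int_mul hE]; ring

omit [IsStrictOrderedRing K] in
/-- `pairStepQ` is symmetric. -/
theorem pairStepQ_comm (F : Finset K) (q : K → K) (E c c' : K) :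
    pairStepQ F q E c c' = pairStepQ F q E c' c := by
  simp only [pairStepQ, stepQ]
  rw [pairLiab_comm E (up F c) (up F c'), pairLiab_comm E (up F c) (dn F c'),
    pairLiab_comm E (dn F c) (up F c'), pairLiab_comm E (dn F c) (dn F c')]
  ring

/-- `PairLE` is symmetric. -/
theorem pairLE_comm (F : Finset K) (q : K → K) (G E c c' : K) :
    PairLE F q G E c c' ↔ PairLE F q G E c' c := by
  unfold PairLE
  rw [pairStepQ_comm, pairLiab_comm E c c']
  constructor <;> intro h <;> linarith

/-- **THE LIABILITY ACCOUNTING THEOREM** (any finite value set `F`, any rule `q : [0,1] → [0,1]`,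
any `G`, `E`, data).  If at every level `k < n` the two-point inequality `PairLE` holds for every
pair of reachable pre-rounding values, and every reachable mean truncation lies in `[0, E]`, then
  `E(ŝₙ − sₙ)² + Λₙ ≤ n·G²/4 + (n·E)²`  and  `0 ≤ sₙ − E[ŝₙ] ≤ n·E`.
Proof: `E(ŝ_{k+1} − s_{k+1})² = E(ŝ_k − s_k)² + L_k` (CXVII) and `Λ_{k+1} = E₂^k[pair step]`
(`acc2_succ`); integrating `PairLE` over two independent copies of the level, the cross term
`E₂[(t − t')(y_t − y_{t'})] = 2E[t·y_t] − 2E[t]E[y_t]` cancels the covariance part of `L_k`, leaving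
`L_k + Λ_{k+1} − Λ_k ≤ G²/4 + E[y²] − E·ȳ + E² + 2(s_k − E[ŝ_k])·ȳ ≤ G²/4 + (2k+1)E²`. -/
theorem acc_sq_add_liab_le (F : Finset K) {q : K → K}
    (hq01 : ∀ θ, 0 ≤ θ → θ ≤ 1 → 0 ≤ q θ ∧ q θ ≤ 1) (G E : K) (x : ℕ → K) (s : K) :
    ∀ n : ℕ,
      (∀ k < n, ∀ t t', Reach F x s k t → Reach F x s k t' → PairLE F q G E (t + x k) (t' + x k)) →
      (∀ k < n, ∀ t, Reach F x s k t → 0 ≤ truncQ F q (t + x k) ∧ truncQ F q (t + x k) ≤ E) →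
      accExpQ F q x n (fun t => (t - (s + ∑ i ∈ range n, x i)) ^ 2) s + liabQ F q E x n s
          ≤ n * (G ^ 2 / 4) + (n * E) ^ 2 ∧
        0 ≤ (s + ∑ i ∈ range n, x i) - accExpQ F q x n (fun t => t) s ∧
        (s + ∑ i ∈ range n, x i) - accExpQ F q x n (fun t => t) s ≤ n * E
  | 0, _, _ => by
      refine ⟨?_, ?_, ?_⟩
      · show (s - (s + ∑ i ∈ range 0, x i)) ^ 2 + pairLiab E s s ≤ _
        rw [pairLiab_self]; simp
      · show 0 ≤ (s + ∑ i ∈ range 0, x i) - s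
        simp
      · show (s + ∑ i ∈ range 0, x i) - s ≤ _
        simp
  | n + 1, HP, HY => by
      obtain ⟨IH, IH0, IH1⟩ := acc_sq_add_liab_le F hq01 G E x s n
        (fun k hk => HP k (Nat.lt_succ_of_lt hk)) (fun k hk => HY k (Nat.lt_succ_of_lt hk))
      have hYm := acc_id_succ_level F q x n s
      -- the mean truncation of level `n` is in `[0, E]`, and `E[y²] ≤ E·E[y]`
      have hy0 : 0 ≤ accExpQ F q x n (fun t => truncQ F q (t + x n)) s := by
        have h := accExpQ_mono_reach F hq01 n x s (fun _ => (0 : K))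
          (fun t => truncQ F q (t + x n)) (fun t ht => (HY n (Nat.lt_succ_self n) t ht).1)
        rwa [accExpQ_const] at h
      have hy1 : accExpQ F q x n (fun t => truncQ F q (t + x n)) s ≤ E := by
        have h := accExpQ_mono_reach F hq01 n x s (fun t => truncQ F q (t + x n)) (fun _ => E)
          (fun t ht => (HY n (Nat.lt_succ_self n) t ht).2)
        rwa [accExpQ_const] at h
      have hy2 : accExpQ F q x n (fun t => truncQ F q (t + x n) ^ 2) s
          ≤ E * accExpQ F q x n (fun t => truncQ F q (t + x n)) s := by
        rw [← accExpQ_const_mul]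
        exact accExpQ_mono_reach F hq01 n x s _ _ (fun t ht => by
          obtain ⟨h0, h1⟩ := HY n (Nat.lt_succ_self n) t ht
          show truncQ F q (t + x n) ^ 2 ≤ E * truncQ F q (t + x n)
          nlinarith)
      refine ⟨?_, ?_, ?_⟩
      · -- the main step
        rw [acc_sq_succ_level]
        unfold liabQ at IH ⊢
        rw [acc2_succ]
        -- the two one-copy integrands of the upper bound
        obtain ⟨A, hA⟩ : ∃ A : K → K, A = fun t => G ^ 2 / 4 - vslackQ F q G (t + x n) / 2
            + truncQ F q (t + x n) ^ 2 - t * truncQ F q (t + x n)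
            + 2 * (s + ∑ i ∈ range n, x i) * truncQ F q (t + x n)
            + E * (E - truncQ F q (t + x n)) / 2 := ⟨_, rfl⟩
        obtain ⟨B, hB⟩ : ∃ B : K → K, B = fun t => t * truncQ F q (t + x n)
            + (vslackQ F q G (t + x n) + E * (E - truncQ F q (t + x n))) / 2 := ⟨_, rfl⟩
        have hlev : levelQ F q x n s = acc2 F q x n (fun t _ =>
            sqStepQ F q (t + x n) - 2 * (t - (s + ∑ i ∈ range n, x i)) * truncQ F q (t + x n)) s := by
          rw [acc2_left]; rfl
        have hmono : acc2 F q x n (fun t _ => sqStepQ F q (t + x n)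
              - 2 * (t - (s + ∑ i ∈ range n, x i)) * truncQ F q (t + x n)) s
            + acc2 F q x n (fun t t' => stepQ F q (t + x n)
                (fun a => stepQ F q (t' + x n) (fun b => pairLiab E a b))) s
            ≤ acc2 F q x n (fun t t' => pairLiab E t t' + A t + B t'
                - t * truncQ F q (t' + x n) - truncQ F q (t + x n) * t') s := by
          rw [← acc2_add]
          refine acc2_mono_reach F hq01 n x s _ _ (fun t t' ht ht' => ?_)
          have hP := HP n (Nat.lt_succ_self n) t t' ht ht'
          unfold PairLE pairStepQ at hP
          rw [pairLiab_add_right, add_sub_add_right_eq_sub] at hP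
          have e1 := sqStepQ_eq F q (t + x n)
          simp only [hA, hB]
          unfold vslackQ at hP ⊢
          linarith [hP, e1]
        have hsplit : acc2 F q x n (fun t t' => pairLiab E t t' + A t + B t'
                - t * truncQ F q (t' + x n) - truncQ F q (t + x n) * t') s
            = acc2 F q x n (pairLiab E) s + accExpQ F q x n A s + accExpQ F q x n B s
              - 2 * (accExpQ F q x n (fun t => t) s
                * accExpQ F q x n (fun t => truncQ F q (t + x n)) s) := by
          rw [acc2_sub, acc2_sub, acc2_add, acc2_add, acc2_left, acc2_right, acc2_mul, acc2_mul]
          ring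
        have hAB : accExpQ F q x n A s + accExpQ F q x n B s
            = (G ^ 2 / 4 + E ^ 2) + accExpQ F q x n (fun t => truncQ F q (t + x n) ^ 2) s
              + (2 * (s + ∑ i ∈ range n, x i) - E)
                * accExpQ F q x n (fun t => truncQ F q (t + x n)) s := by
          have e : accExpQ F q x n A s + accExpQ F q x n B s
              = accExpQ F q x n (fun t => 1 * A t + 1 * B t) s := by rw [accExpQ_lin]; ring
          have e2 : (fun t => 1 * A t + 1 * B t)
              = fun t => (G ^ 2 / 4 + E ^ 2) * 1 + 1 * (1 * truncQ F q (t + x n) ^ 2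
                + (2 * (s + ∑ i ∈ range n, x i) - E) * truncQ F q (t + x n)) := by
            funext t; simp only [hA, hB]; ring
          rw [e, e2, accExpQ_lin, accExpQ_lin, accExpQ_const]; ring
        have hprod : ((s + ∑ i ∈ range n, x i) - accExpQ F q x n (fun t => t) s)
            * accExpQ F q x n (fun t => truncQ F q (t + x n)) s ≤ (n * E) * E :=
          mul_le_mul IH1 hy1 hy0 (IH0.trans IH1)
        rw [hlev]
        push_cast
        linarith [hmono, hsplit, hAB, IH, hy2, hprod]
      · linarith [hYm, IH0, hy0]
      · push_cast; linarith [hYm, IH1, hy1]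

/-- **Corollary**: under the same hypotheses and `E > 0`, the Pythagorean law
`E(ŝₙ − sₙ)² ≤ n·G²/4 + (n·E)²` (the liability is nonnegative). -/
theorem acc_sq_le_of_pairLE (F : Finset K) {q : K → K}
    (hq01 : ∀ θ, 0 ≤ θ → θ ≤ 1 → 0 ≤ q θ ∧ q θ ≤ 1) (G : K) {E : K} (hE : 0 < E) (x : ℕ → K)
    (s : K) (n : ℕ)
    (HP : ∀ k < n, ∀ t t', Reach F x s k t → Reach F x s k t' → PairLE F q G E (t + x k) (t' + x k))
    (HY : ∀ k < n, ∀ t, Reach F x s k t → 0 ≤ truncQ F q (t + x k) ∧ truncQ F q (t + x k) ≤ E) :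
    accExpQ F q x n (fun t => (t - (s + ∑ i ∈ range n, x i)) ^ 2) s ≤ n * (G ^ 2 / 4) + (n * E) ^ 2 := by
  have h := (acc_sq_add_liab_le F hq01 G E x s n HP HY).1
  have hL : 0 ≤ liabQ F q E x n s := by
    have h0 := acc2_mono_reach F hq01 n x s (fun _ _ => (0 : K)) (pairLiab E)
      (fun t t' _ _ => pairLiab_nonneg hE t t')
    rw [acc2_left, accExpQ_const] at h0
    exact h0
  linarith

end LimitedBits

end Summit.Ventures.CertifiedArithmetic.LowPrec.SR
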